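import Mathlib.Topology.Algebra.OpenSubgroup
import Mathlib.GroupTheory.Index
import Mathlib.Data.Nat.Prime.Basic
import HarnessLib

/-!
# [IUTchIV] Proposition 1.8 (Torsion Points of Elliptic Curves) — typed as an INTERFACE of named
# classical facts

Mochizuki, *Inter-universal Teichmüller theory IV*, RIMS manuscript (Apr. 2020; = PRIMS **57** (2021)),
§1, Proposition 1.8 (i)–(vii), pp. 18–19; printed proof pp. 19–21 citing [Milne] Prop. 17.5 / Thm. 12.5
(Serre's criterion), [Silv] III Prop. 1.4 and VII Prop. 5.4 (c), [Harts] IV Prop. 4.6, [NerMod] §7.4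
Thms. 5, 6. The content is CLASSICAL ("we review some well-known elementary facts concerning elliptic
curves", p. 18) and undisputed; the series' bibliographic key carries the D-0012 status, hence the tags.

Why an interface. The statements quantify over abelian varieties / elliptic curves over a perfect field
`k` with its absolute Galois group, the automorphism groups `Aut_k̄(E_k̄) ⊆ Aut_k(E_k̄)` (automorphisms of
the SCHEME `E_k̄` lying over automorphisms of `k̄/k`), torsion Galois representations, models/descent data,
and (for (v)–(vii)) semi-stable / good / multiplicative reduction over a complete discrete valuation ring
(Néron models). Mathlib (v4.32) has Weierstrass curves and their group law but none of: Tate modules of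
abelian varieties, the semilinear automorphism group `Aut_k(E_k̄)`, reduction types, Néron models. So the
printed assertions are typed here OVER AN INTERFACE: a structure `TorsionSetting` bundling exactly the
objects Prop. 1.8 names (with the printed relations that are DEFINITIONS, e.g. "`G_E` := the image",
"`k_E` := the field determined by `G_E`", as fields/defs), and each of (i)–(vii) as a `Prop`-valued
definition over it — a NAMED FACT to be taken as a hypothesis `(h : P18_ii S)` by consumers ([IUTchIV]
Thm 1.10 uses (ii), (iii), (iv), (v), (vi), (vii) for `F_tpd`, `F`, (D0), (R1)–(R4); Cor. 2.2 uses
(ii)–(vi)), and to be DISCHARGED by instantiating the interface from real definitions when the tree has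
them. Nothing is asserted. Each `Prop` quotes the printed clause it transcribes.

Interface dictionary (`S : TorsionSetting`): `S.Gk` = `G_k = Gal(k̄/k)` (a topological group);
`S.AutBar` = `Aut_k̄(E_k̄)`; `S.AutK` = `Aut_k(E_k̄)`; `S.incl : AutBar →* AutK`, `S.proj : AutK →* Gk` (the
"natural exact sequence" maps); `S.Tor n` = `E_k̄[n]` with `S.ρ n : AutK →* AddMonoid.End (Tor n)` ("natural
representation"; a homomorphism from a group lands in the automorphisms); `S.GE := S.proj.range` (`G_E`); models of `E_k̄` over the fixed field `k_H` of a closed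
`H ≤ G_k` are, BY (ii), sections of `proj` over `H` — we take "model over `k_H`" to MEAN such a section
(`S.Model H`), so that the last sentence of (ii) becomes a definition and (iv)–(vii) are statements about
sections; `charUnitK p` = "`p` is invertible in `k`", `charUnitO p` = "`p` is invertible in `O_k`" (residue
characteristic; (v)–(vii) and the reduction half of (vi)); for (v)–(vii) the inertia and wild
inertia subgroups `S.inertia ≥ S.wildInertia` of `G_k` (when `k` is a complete discrete valuation field)
and reduction-type predicates on models.

Deliberately NOT here: abelian varieties of dimension `> 1` in (i) (we type the elliptic-curve case, which
is all that [IUTchIV] uses); the moduli stacks `(M̄_ell)_R`; any proof.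
-/

namespace Literature.IUT.LogVolume

namespace Prop18

/-- The objects named in [IUTchIV] Prop. 1.8 for one elliptic curve `E_k̄` over `k̄`, `k` perfect (p. 18):
`G_k`, `Aut_k̄(E_k̄) ⊆ Aut_k(E_k̄) → G_k`, the torsion modules `E_k̄[n]` with the natural representations
`ρ_n`, which primes are invertible in `k` (resp. in `O_k`), and — for the local statements (v)–(vii), `k` a
complete discrete valuation field — the inertia and wild inertia subgroups of `G_k` and the reduction type
of a model. Relations that the text DEFINES are fields here; relations it ASSERTS are the `Prop`s below.
[claim: Mochizuki2012, status: disputed] -/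
structure TorsionSetting where
  /-- `G_k := Gal(k̄/k)` -/
  Gk : Type
  /-- group structure -/
  instGroupGk : Group Gk
  /-- the Krull topology -/
  instTopGk : TopologicalSpace Gk
  /-- `Aut_k̄(E_k̄)`, the `ε_E`-preserving `k̄`-automorphisms -/
  AutBar : Type
  /-- group structure -/
  instGroupAutBar : Group AutBar
  /-- `Aut_k(E_k̄)`, the `ε_E`-preserving automorphisms of the `k`-scheme `E_k̄` -/
  AutK : Type
  /-- group structure -/
  instGroupAutK : Group AutK
  /-- `Aut_k̄(E_k̄) ⊆ Aut_k(E_k̄)` -/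
  incl : AutBar →* AutK
  /-- `Aut_k(E_k̄) → G_k` ("any automorphism of the scheme `E_k̄` lies over an automorphism of `k̄`", p. 20) -/
  proj : AutK →* Gk
  /-- `E_k̄[n] ⊆ E_k̄(k̄)`, the module of `n`-torsion points -/
  Tor : ℕ → Type
  /-- abelian group structure -/
  instTor : ∀ n, AddCommGroup (Tor n)
  /-- the natural representation `ρ_n : Aut_k(E_k̄) → Aut(E_k̄[n])` -/
  ρ : ∀ n, letI := instTor n; AutK →* AddMonoid.End (Tor n)
  /-- "`p` is invertible in `k`" (a condition on the characteristic of `k`) -/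
  charUnitK : ℕ → Prop
  /-- (local statements, `k` a complete discrete valuation field) "`p` is invertible in `O_k`" (a condition on
  the RESIDUE characteristic) -/
  charUnitO : ℕ → Prop
  /-- invertible in `O_k` implies invertible in `k` -/
  charUnitO_le : ∀ p, charUnitO p → charUnitK p
  /-- `j`-invariant datum: "the field generated over `k` by the `j`-invariant", as a closed subgroup of `G_k` -/
  Gj : Subgroup Gk
  /-- (local statements) the inertia subgroup `I_k ≤ G_k` -/
  inertia : Subgroup Gk
  /-- (local statements) the wild inertia subgroup `P_k ≤ I_k` -/
  wildInertia : Subgroup Gk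
  /-- `P_k ≤ I_k` -/
  wild_le : wildInertia ≤ inertia
  /-- (local statements) "has semi-stable reduction over `O_{k_H}` [i.e., extends to a semi-abelian scheme]"
  for a model given by a section over `H` -/
  SemistableReduction : ∀ H : Subgroup Gk, (H →* AutK) → Prop
  /-- (local statements) "has good reduction [i.e., extends to an abelian scheme]" -/
  GoodReduction : ∀ H : Subgroup Gk, (H →* AutK) → Prop
  /-- (local statements) "has bad multiplicative reduction [i.e., extends to a non-proper semi-abelian scheme]" -/
  MultiplicativeReduction : ∀ H : Subgroup Gk, (H →* AutK) → Prop
  /-- "is defined by means of the Legendre form of the Weierstrass equation" (for a model over `k`) -/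
  IsLegendre : (Gk →* AutK) → Prop

attribute [instance] TorsionSetting.instGroupGk TorsionSetting.instTopGk TorsionSetting.instGroupAutBar
  TorsionSetting.instGroupAutK TorsionSetting.instTor

namespace TorsionSetting

/-- `G_E ⊆ G_k`, "the image … of the homomorphism `Aut_k(E_k̄) → G_k`" ((ii), p. 19).
[claim: Mochizuki2012, status: disputed] -/
def GE (S : TorsionSetting) : Subgroup S.Gk := S.proj.range

/-- "`[k′ : k] ≤ 2`" for the fixed field `k′ = k_H` of `H ≤ G_k`: the index of `H` is `1` or `2` (NOT
`H.index ≤ 2`, whose Mathlib junk value `index = 0` for infinite index would admit `H = ⊥`, i.e. `k′ = k̄`).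
[cite: Mochizuki2012, IUTchIV Prop 1.8 (vi) p.19] -/
def degLeTwo (S : TorsionSetting) (H : Subgroup S.Gk) : Prop := H.index = 1 ∨ H.index = 2

/-- A MODEL of `E_k̄` over `k_H` (`H ≤ G_k` closed, fixed field `k_H`): by the last sentence of (ii) ("the datum
of a model of `E_k̄` over `k_H` [i.e., descent data for `E_k̄` from `k̄` to `k_H`] is equivalent to the datum of
a section of the homomorphism `Aut_k(E_k̄) → G_k` over `H`") we take it to BE such a section.
[claim: Mochizuki2012, status: disputed] -/
def Model (S : TorsionSetting) (H : Subgroup S.Gk) : Type := {s : H →* S.AutK // ∀ h : H, S.proj (s h) = h}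

/-- The Galois action on `E[n]` of a model `s` over `k_H`: `h ↦ ρ_n(s(h))`. [claim: Mochizuki2012, status: disputed] -/
def torsionAction (S : TorsionSetting) {H : Subgroup S.Gk} (s : S.Model H) (n : ℕ) :
    H →* AddMonoid.End (S.Tor n) :=
  (S.ρ n).comp s.1

/-- "all of whose `l`-torsion points are rational over `k_H`": the Galois action of the model on `E[l]` is
trivial. [claim: Mochizuki2012, status: disputed] -/
def TorsionRational (S : TorsionSetting) {H : Subgroup S.Gk} (s : S.Model H) (l : ℕ) : Prop :=
  ∀ h : H, S.torsionAction s l h = 1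

/-- Two models over `k_H` are ISOMORPHIC over `k_H`: their sections are conjugate by an element of
`Aut_k̄(E_k̄)`. [claim: Mochizuki2012, status: disputed] -/
def ModelIso (S : TorsionSetting) {H : Subgroup S.Gk} (s s' : S.Model H) : Prop :=
  ∃ a : S.AutBar, ∀ h : H, s'.1 h = S.incl a * s.1 h * (S.incl a)⁻¹

/-! ## The seven assertions as named facts over the interface -/

/-- **Prop. 1.8 (i) (“Serre’s Criterion”)**, elliptic-curve case (p. 18): "Let `l ≥ 3` be a prime number
that is invertible in `k` … Then the natural map `φ : Aut_k̄(A, λ) → Aut(A[l])` … is injective."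
[cite: Milne1986AbelianVarieties, Prop 17.5] -/
def P18_i (S : TorsionSetting) : Prop :=
  ∀ l : ℕ, l.Prime → 3 ≤ l → S.charUnitK l → Function.Injective ((S.ρ l).comp S.incl)

/-- **Prop. 1.8 (ii)** (pp. 18–19): "we have a natural exact sequence `1 → Aut_k̄(E_k̄) → Aut_k(E_k̄) → G_k`
— where the image `G_E ⊆ G_k` … is open — and a natural representation `ρ_n` … The finite extension `k_E`
of `k` determined by `G_E` is the minimal field of definition of `E_k̄`, i.e., the field generated over `k`
by the `j`-invariant … the homomorphism `Aut_k(E_k̄) → G_k` admits a section over `G_E`."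
[claim: Mochizuki2012, status: disputed] -/
def P18_ii (S : TorsionSetting) : Prop :=
  Function.Injective S.incl ∧ S.incl.range = S.proj.ker ∧ IsOpen (S.GE : Set S.Gk) ∧
    S.GE = S.Gj ∧ Nonempty (S.Model S.GE)

/-- **Prop. 1.8 (iii)** (p. 19): "suppose further that `Aut_k̄(E_k̄) = {±1}`. Then the representation `ρ_2`
factors through `G_E` and hence defines a natural representation `G_E → Aut(E_k̄[2])`."
[claim: Mochizuki2012, status: disputed] -/
def P18_iii (S : TorsionSetting) : Prop :=
  Nat.card S.AutBar = 2 →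
    ∃ ρbar : S.GE →* AddMonoid.End (S.Tor 2), ∀ a : S.AutK, S.ρ 2 a = ρbar ⟨S.proj a, ⟨a, rfl⟩⟩

/-- **Prop. 1.8 (iv)** (p. 19): "suppose further that `l ≥ 3` is a prime number that is invertible in `k`,
and that `E_k̄` descends to elliptic curves `E′_k` and `E″_k` over `k`, all of whose `l`-torsion points are
rational over `k`. Then `E′_k` is isomorphic to `E″_k` over `k`." [claim: Mochizuki2012, status: disputed] -/
def P18_iv (S : TorsionSetting) : Prop :=
  ∀ l : ℕ, l.Prime → 3 ≤ l → S.charUnitK l →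
    ∀ s s' : S.Model ⊤, S.TorsionRational s l → S.TorsionRational s' l → S.ModelIso s s'

/-- **Prop. 1.8 (v)** (p. 19; `k` a complete discrete valuation field): "suppose … that `l ≥ 3` is a prime
number that is invertible in `O_k`, and that `E_k̄` descends to an elliptic curve `E_k` over `k`, all of whose
`l`-torsion points are rational over `k`. Then `E_k` has semi-stable reduction over `O_k`." (Printed proof: level-`l` structures make the moduli stack a proper scheme over
`ℤ[1/l]`; valuative criterion.) [cite: Mochizuki2012, IUTchIV Prop 1.8 (v) p.19] -/
def P18_v (S : TorsionSetting) : Prop :=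
  ∀ l : ℕ, l.Prime → 3 ≤ l → S.charUnitO l →
    ∀ s : S.Model ⊤, S.TorsionRational s l → S.SemistableReduction ⊤ s.1

/-- **Prop. 1.8 (vi)** (p. 19): "In the situation of (iii), suppose further that `2` is invertible in `k`,
that `G_E = G_k`, and that the representation `G_E → Aut(E_k̄[2])` is trivial. Then `E_k̄` descends to an
elliptic curve `E_k` over `k` which is defined by means of the Legendre form … If, moreover, `k` is a
complete discrete valuation field … such that `2` is invertible in `O_k`, then `E_k` has semi-stable
reduction over `O_{k′}` … for some finite extension `k′ ⊆ k̄` of `k` such that `[k′ : k] ≤ 2`; if `E_k` has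
good reduction over `O_{k′}` …, then one may in fact take `k′` to be `k`." The first part is under "`2`
invertible in `k`" (printed proof p. 20 via [Harts] IV Prop. 4.6), the reduction part under "`2` invertible in
`O_k`" and about THE `k′` produced (printed proof p. 21: [Silv] VII Prop. 5.4 (c), bib `SilvermanAEC2009`).
Models carry no continuity requirement here (no topology on `Aut_k(E_k̄)`); harmless for these statements.
[cite: Mochizuki2012, IUTchIV Prop 1.8 (vi) p.19] -/
def P18_vi (S : TorsionSetting) : Prop :=
  Nat.card S.AutBar = 2 → S.charUnitK 2 → S.GE = ⊤ →
    (∀ a : S.AutK, S.ρ 2 a = 1) →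
      ∃ s : S.Model ⊤, S.IsLegendre (s.1.comp (Subgroup.topEquiv (G := S.Gk)).symm.toMonoidHom) ∧
        (S.charUnitO 2 →
          ∃ H : Subgroup S.Gk, S.degLeTwo H ∧ S.SemistableReduction H (s.1.comp (Subgroup.inclusion le_top)) ∧
            (S.GoodReduction H (s.1.comp (Subgroup.inclusion le_top)) → S.GoodReduction ⊤ s.1))

/-- **Prop. 1.8 (vii)** (p. 19; `k` a complete discrete valuation field, `E_k` a model over `k`, `n`
invertible in `O_k`): "If `E_k` has good reduction over `O_k` …, then the action of `G_k` on `E_k[n]` is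
unramified. If `E_k` has bad multiplicative reduction over `O_k` …, then the kernel of the action of `G_k` on
`E_k[n]` determines a tamely ramified extension of `k` whose ramification index over `k` divides `n`."
Here `n` is invertible in `O_k` (residue characteristic prime to `n`). Unramified = inertia acts trivially;
tame = wild inertia acts trivially; ramification index = the index of the kernel in inertia.
[cite: BLRNeronModels1990, §7.4 Thm 5, Thm 6] -/
def P18_vii (S : TorsionSetting) : Prop :=
  ∀ n : ℕ, 1 ≤ n → S.charUnitO n → ∀ s : S.Model ⊤,
    (S.GoodReduction ⊤ s.1 →
      ∀ g : S.Gk, g ∈ S.inertia → S.torsionAction s n ⟨g, trivial⟩ = 1) ∧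
    (S.MultiplicativeReduction ⊤ s.1 →
      (∀ g : S.Gk, g ∈ S.wildInertia → S.torsionAction s n ⟨g, trivial⟩ = 1) ∧
        (((S.torsionAction s n).ker.map (⊤ : Subgroup S.Gk).subtype).subgroupOf S.inertia).index ∣ n)

/-- **[IUTchIV] Proposition 1.8** as one hypothesis: the conjunction of (i)–(vii) over the interface.
Consumers take `(h : S.P18)`; instantiating `S` from real definitions and proving `S.P18` discharges it.
[claim: Mochizuki2012, status: disputed] -/
def P18 (S : TorsionSetting) : Prop := S.P18_i ∧ S.P18_ii ∧ S.P18_iii ∧ S.P18_iv ∧ S.P18_v ∧ S.P18_vi ∧ S.P18_vii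

end TorsionSetting

end Prop18

end Literature.IUT.LogVolume
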